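import Literature.Probability.Percolation.CornerPercolation
import Literature.Probability.Percolation.RSWProofs
import HarnessLib

/-!
# Stub `stub_glue` (crux stmt-CriticalPhenomena-5476 `UniformBoxCrossing`, line `Sketch`):
# hard-way `2:1` crossings ⇒ lower bounds at every bounded aspect ratio, uniformly in `t`

The classical Russo–Seymour–Welsh gluing step for the corner percolation models
`M_t = cornerPercolation t` on `ℤ²`, `t ∈ [0, 1]` (Bollobás–Riordan, *Percolation* (2006), Ch. 3,
eq. (2)–(3), there for bond percolation at `p = 1/2`; the tree's `crossingProb_glue_holds` /
`rsw_lowerBound_of_glue` are the `P_p` versions and served as the template).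

* `cornerPercolation_real_lrCrossing_anti_left` — `M_t(LR(m', n)) ≤ M_t(LR(m, n))` for `m ≤ m'`
  (`lrCrossing_anti_left` on the `M_t`-sure set of lattice configurations).
* `cornerPercolation_half_le_real_tbCrossing_self` — `1/2 ≤ M_t(TB([0, n]²))`, from the exact
  identity `M_t(LR([0, n + 1] × [0, n])) = 1/2` (`cornerPercolation_real_lrCrossing_succ_self`),
  transposition symmetry and antitonicity in the width.
* `cornerPercolation_real_glue` — the gluing inequality
  `M_t(LR(m₁, n)) · M_t(LR(m₂, n)) · M_t(TB(n, n)) ≤ M_t(LR(m₁ + m₂ - n, n))` for `n ≤ m₁, m₂`: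
  the deterministic step `lrCrossing_of_glue`, Harris–FKG for `M_t`
  (`cornerPercolation_real_inter_ge`) twice, and translation invariance
  (`cornerPercolation_real_openCrossing_shift`).
* `cornerPercolation_real_lrCrossing_mul_ge` — iterating: `c ≤ M_t(LR(2N, N))` gives
  `c^(i+1) (1/2)^i ≤ M_t(LR((i + 2) N, N))`.
* `stub_glue` — the registered stub: a uniform (in `t`) lower bound for the hard-way crossing of
  `[0, 2n] × [0, n]`, `n ≥ n₀`, gives for every `k` the uniform bound
  `c^(k+1) 2^{-k} ≤ M_t(LR([0, M] × [0, N]))` for all `N ≥ n₀`, `M ≤ k N` (via `M ≤ (k + 2) N` and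
  antitonicity in the width; no case distinction on `k` or `N` is needed).
-/

noncomputable section

namespace Summit.CriticalPhenomena.CardyFormulaZ2.Cruxes.UniformBoxCrossing.NonSlantLine

open MeasureTheory Literature.Probability.Percolation Literature.Probability.LatticeModels

/-- **Antitonicity in the width for `M_t`**: `M_t(LR([0, m'] × [0, n])) ≤ M_t(LR([0, m] × [0, n]))`
for `m ≤ m'` — `lrCrossing_anti_left` holds on lattice configurations, an `M_t`-sure set
(`cornerPercolation_subset_edgeSet`). (Bollobás–Riordan 2006, Ch. 3, proof of eq. (3), for
`P_{1/2}`.) [folklore] -/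
theorem cornerPercolation_real_lrCrossing_anti_left (t : unitInterval) {m m' : ℕ} (h : m ≤ m')
    (n : ℕ) :
    (cornerPercolation t).real (lrCrossing m' n) ≤ (cornerPercolation t).real (lrCrossing m n) := by
  simp only [measureReal_def]
  refine ENNReal.toReal_mono (measure_ne_top _ _) (measure_mono_ae ?_)
  filter_upwards [cornerPercolation_subset_edgeSet t] with ω hω hc
  exact lrCrossing_anti_left h n hω hc

/-- **Squares are crossed vertically with probability at least `1/2`** under every `M_t`:
`1/2 = M_t(LR([0, n + 1] × [0, n])) ≤ M_t(LR([0, n]²)) = M_t(TB([0, n]²))`.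
(Bollobás–Riordan 2006, Ch. 3, Corollary 3(iii), for `P_{1/2}`.) [folklore] -/
theorem cornerPercolation_half_le_real_tbCrossing_self (t : unitInterval) (n : ℕ) :
    1 / 2 ≤ (cornerPercolation t).real (tbCrossing n n) := by
  rw [cornerPercolation_real_tbCrossing, ← cornerPercolation_real_lrCrossing_succ_self t n]
  exact cornerPercolation_real_lrCrossing_anti_left t (Nat.le_succ n) n

/-- **The gluing inequality for `M_t`** (Bollobás–Riordan 2006, Ch. 3, eq. (2) with Figure 7, in
the form Harris's lemma gives): for `n ≤ m₁, m₂`,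
`M_t(LR(m₁, n)) · M_t(LR(m₂, n)) · M_t(TB(n, n)) ≤ M_t(LR(m₁ + m₂ - n, n))`.
With `R₁ = [0, m₁] × [0, n]`, `S = [m₁ - n, m₁] × [0, n]`, `R₂ = [m₁ - n, m₁ + m₂ - n] × [0, n]`:
on lattice configurations (an `M_t`-sure set) horizontal crossings of `R₁`, `R₂` and a vertical
crossing of `S` give a horizontal crossing of `R₁ ∪ R₂` (`lrCrossing_of_glue`); the three events
are increasing and measurable, so Harris–FKG for `M_t` (`cornerPercolation_real_inter_ge`)
applies twice; the translated events have the untranslated probabilities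
(`cornerPercolation_real_openCrossing_shift`). [cite: BollobasRiordan2006, Ch. 3, eq. (2)] -/
theorem cornerPercolation_real_glue (t : unitInterval) {m₁ m₂ n : ℕ} (hn₁ : n ≤ m₁)
    (hn₂ : n ≤ m₂) :
    (cornerPercolation t).real (lrCrossing m₁ n) * (cornerPercolation t).real (lrCrossing m₂ n) *
        (cornerPercolation t).real (tbCrossing n n) ≤
      (cornerPercolation t).real (lrCrossing (m₁ + m₂ - n) n) := by
  classical
  set v := glueShift m₁ n with hv
  set H₁ := lrCrossing m₁ n with hH₁
  set V := openCrossing ((· + v) '' (↑(rectangle n n) : Set (Site 2)))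
    ((· + v) '' ↑(bottomSide n n)) ((· + v) '' ↑(topSide n n)) with hVdef
  set H₂ := openCrossing ((· + v) '' (↑(rectangle m₂ n) : Set (Site 2)))
    ((· + v) '' ↑(leftSide m₂ n)) ((· + v) '' ↑(rightSide m₂ n)) with hH₂def
  have hPV : (cornerPercolation t).real V = (cornerPercolation t).real (tbCrossing n n) := by
    rw [hVdef, cornerPercolation_real_openCrossing_shift]
    rfl
  have hPH₂ : (cornerPercolation t).real H₂ = (cornerPercolation t).real (lrCrossing m₂ n) := by
    rw [hH₂def, cornerPercolation_real_openCrossing_shift]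
    rfl
  have hup₁ : IsUpperSet H₁ := isUpperSet_lrCrossing _ _
  have hupV : IsUpperSet V := isUpperSet_openCrossing _ _ _
  have hup₂ : IsUpperSet H₂ := isUpperSet_openCrossing _ _ _
  have hms₁ : MeasurableSet H₁ := measurableSet_lrCrossing _ _
  have hmsV : MeasurableSet V := measurableSet_openCrossing_of_countable _ _ _
  have hms₂ : MeasurableSet H₂ := measurableSet_openCrossing_of_countable _ _ _
  have h12 : (cornerPercolation t).real H₁ * (cornerPercolation t).real V ≤
      (cornerPercolation t).real (H₁ ∩ V) :=
    cornerPercolation_real_inter_ge t hup₁ hupV hms₁ hmsV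
  have h123 : (cornerPercolation t).real (H₁ ∩ V) * (cornerPercolation t).real H₂ ≤
      (cornerPercolation t).real (H₁ ∩ V ∩ H₂) :=
    cornerPercolation_real_inter_ge t (hup₁.inter hupV) hup₂ (hms₁.inter hmsV) hms₂
  have hsub : (cornerPercolation t).real (H₁ ∩ V ∩ H₂) ≤
      (cornerPercolation t).real (lrCrossing (m₁ + m₂ - n) n) := by
    simp only [measureReal_def]
    refine ENNReal.toReal_mono (measure_ne_top _ _) (measure_mono_ae ?_)
    filter_upwards [cornerPercolation_subset_edgeSet t] with ω hω hmem
    exact lrCrossing_of_glue hn₁ hn₂ hω hmem.1.1 hmem.1.2 hmem.2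
  calc (cornerPercolation t).real H₁ * (cornerPercolation t).real (lrCrossing m₂ n) *
        (cornerPercolation t).real (tbCrossing n n)
      = (cornerPercolation t).real H₁ * (cornerPercolation t).real V *
          (cornerPercolation t).real H₂ := by rw [hPV, hPH₂]; ring
    _ ≤ (cornerPercolation t).real (H₁ ∩ V) * (cornerPercolation t).real H₂ :=
        mul_le_mul_of_nonneg_right h12 measureReal_nonneg
    _ ≤ (cornerPercolation t).real (H₁ ∩ V ∩ H₂) := h123
    _ ≤ (cornerPercolation t).real (lrCrossing (m₁ + m₂ - n) n) := hsub

/-- **Iterated gluing** (Bollobás–Riordan 2006, Ch. 3, between eq. (2) and eq. (3), for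
`P_{1/2}`): if `c ≤ M_t(LR([0, 2N] × [0, N]))` with `0 ≤ c`, then
`c^(i+1) (1/2)^i ≤ M_t(LR([0, (i + 2) N] × [0, N]))` for every `i`, by induction: glue the
`(i + 2) N` by `N` rectangle and a `2N` by `N` rectangle through an `N`-square, which `M_t`
crosses vertically with probability `≥ 1/2`. [folklore] -/
theorem cornerPercolation_real_lrCrossing_mul_ge (t : unitInterval) {c : ℝ} (hc : 0 ≤ c) {N : ℕ}
    (hN : c ≤ (cornerPercolation t).real (lrCrossing (2 * N) N)) (i : ℕ) :
    c ^ (i + 1) * (1 / 2) ^ i ≤ (cornerPercolation t).real (lrCrossing ((i + 2) * N) N) := by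
  induction i with
  | zero => simpa using hN
  | succ i ih =>
    have hw : (i + 2) * N + 2 * N - N = (i + 1 + 2) * N := by
      rw [show (i + 2) * N + 2 * N = (i + 1 + 2) * N + N by ring, Nat.add_sub_cancel]
    have hle : N ≤ (i + 2) * N := by
      calc N = 1 * N := (one_mul N).symm
        _ ≤ (i + 2) * N := Nat.mul_le_mul_right N (by omega)
    have hg := cornerPercolation_real_glue t (m₁ := (i + 2) * N) (m₂ := 2 * N) (n := N) hle
      (by omega)
    rw [hw] at hg
    refine le_trans ?_ hg
    have hV := cornerPercolation_half_le_real_tbCrossing_self t N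
    calc c ^ (i + 1 + 1) * (1 / 2) ^ (i + 1) = c ^ (i + 1) * (1 / 2) ^ i * c * (1 / 2) := by ring
      _ ≤ (cornerPercolation t).real (lrCrossing ((i + 2) * N) N) *
            (cornerPercolation t).real (lrCrossing (2 * N) N) *
            (cornerPercolation t).real (tbCrossing N N) :=
        mul_le_mul (mul_le_mul ih hN hc measureReal_nonneg) hV (by norm_num)
          (mul_nonneg measureReal_nonneg measureReal_nonneg)

/-- **Stub 4 (gluing: hard-way `2:1` ⇒ every bounded aspect ratio).** From a uniform lower bound
for `M_t(LR([0,2n] × [0,n]))`: for every `k` there are `c > 0` and `n₀` with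
`c ≤ M_t(LR([0,M] × [0,N]))` whenever `N ≥ n₀` and `M ≤ k N` (iterate the gluing inequality
`lrCrossing_of_glue` through squares, which `M_t` crosses vertically with probability `≥ 1/2`,
`cornerPercolation_real_lrCrossing_succ_self`; Harris–FKG `cornerPercolation_real_inter_ge`;
translation invariance; antitonicity in the width). Explicitly `c_k = c^(k+1) 2^{-k}` with the
same `n₀`, since `M ≤ k N ≤ (k + 2) N`. (Bollobás–Riordan 2006, Ch. 3, eq. (2)–(3).)
[cite: BollobasRiordan2006, Ch. 3, eq. (3)] -/
theorem stub_glue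
    (hHW : ∃ c : ℝ, 0 < c ∧ ∃ n₀ : ℕ, ∀ (t : unitInterval) (n : ℕ), n₀ ≤ n →
      c ≤ (cornerPercolation t).real (lrCrossing (2 * n) n)) :
    ∀ k : ℕ, ∃ c : ℝ, 0 < c ∧ ∃ n₀ : ℕ, ∀ (t : unitInterval) (M N : ℕ), n₀ ≤ N → M ≤ k * N →
      c ≤ (cornerPercolation t).real (lrCrossing M N) := by
  obtain ⟨c, hc, n₀, h⟩ := hHW
  intro k
  refine ⟨c ^ (k + 1) * (1 / 2) ^ k, by positivity, n₀, fun t M N hN hM => ?_⟩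
  have hMk : M ≤ (k + 2) * N := hM.trans (Nat.mul_le_mul_right N (by omega))
  calc c ^ (k + 1) * (1 / 2) ^ k ≤ (cornerPercolation t).real (lrCrossing ((k + 2) * N) N) :=
      cornerPercolation_real_lrCrossing_mul_ge t hc.le (h t N hN) k
    _ ≤ (cornerPercolation t).real (lrCrossing M N) :=
      cornerPercolation_real_lrCrossing_anti_left t hMk N

end Summit.CriticalPhenomena.CardyFormulaZ2.Cruxes.UniformBoxCrossing.NonSlantLine

end
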